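import Summits.RiemannHypothesis.RiemannHypothesis.Theorems.Splittings.LiCriterionProgressionsBL
import Summits.RiemannHypothesis.RiemannHypothesis.Theorems.LiHeightLawLog
import Summits.RiemannHypothesis.Statement
import HarnessLib

/-!
# Splittings — Li's criterion along RESIDUE CLASSES (class `0 mod q` = theorem; odd class = multiset-false)
# and the density-sharpened Li HEIGHT-LAW family with its landed rung `c = 2` (SPLIT-li-finite, gen 2 §9)

Cell rh-split, seat rh-split-li-finite g2 (brief sha16 f79c5f09d8bcb036), card
`run/shared/lean/pub/rh-split/cards/SPLIT-li-finite.md` §9 (B)/(V16); zero-definition raw form of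
`HOME/rh-split-li-finite/SketchG2.lean` §3–§4 (sha16 1349f1ff13a79377; proofs verbatim, the seat-local
definitions `LiResidueClassCriterion`, `LiHeightLawDensity` SPELLED OUT).

§1 (census V16) **Li along residue classes.** «RH ↔ (λ_n)_{n ≡ a (mod q)} bounded below»:
* `riemannHypothesis_iff_keiperLiCoeff_residueClass_zero_bddBelow` — the class `a ≡ 0` is a THEOREM for every
  `q ≥ 1` (it is the progression `qℕ` of the landed `riemannHypothesis_iff_keiperLiCoeff_mul_bddBelow`,
  Bombieri–Lagarias road, `LiCriterionProgressionsBL.lean`);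
* `oddClass_witness_sum` / `oddClass_witness_offLine` — MULTISET-LEVEL WITNESS against the odd class
  (`q = 2`, `a = 1`): the conjugation-closed pair with `1 − 1/ρ = ± i·r` has Li sum exactly `2 > 0` at every odd
  index, while for `r > 1` it lies OFF the line (`Re ρ < 1/2`) — so «Li sums bounded below along odd `n` ⟹ all
  `Re ρ ≥ 1/2`» is false for Bombieri–Lagarias multisets, and the `ζ`-level statement for `a ≢ 0` needs
  ARITHMETIC input (on paper: a verified height `H ≳ a` forces `|arg(1 − 1/ρ)| < 1/H` on off-line zeros, so the
  simultaneous return at `N ≡ 0 (q)` read at `N + a` stays negative; referee 19:46Z: for `a ≲ 22` no numerical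
  height is needed since `|Im ρ| > 14` — a provable-now `ζ`-level TARGET, not claimed here).

§2 (card §9 (B)) **The density-sharpened exchange law — family and landed rung.**  «Li height law with constant
`c`» := `∃ T₀, ∀ T ≥ T₀, RiemannHypothesisUpTo T → ∀ 1 ≤ n ≤ c·T²·log T, 0 ≤ λ_n` (RH-FREE, proof-of-data:
finitely many coefficients from a finite verified height).  Proved: the family is monotone in `c`
(`liHeightLaw_const_mono`), the rung `c = 2` holds with `T₀ = 1000` (`liHeightLaw_const_two`, from the tree
theorem `LiTheory.liHeightLawLog_holds`, Brown's logarithmic range — standard axioms), and RH gives every `c`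
(`liHeightLaw_const_of_rh`).  TARGET (typed on the card only, OPEN): every `c < 4` from RH(T) + a zero-DENSITY
input with exponent `A ≤ 4` (tree `zeroDensity_huxley_holds`, `A = 12/5`); CEILING `c = 4` over
Bombieri–Lagarias multisets (one admissible off-line quartet just above `T` makes the Li sum negative at
`n ≈ 4T² log T`).  As a FIN conjunct the law is idle (referee: «density law idle as FIN, RH-free proof-of-data»).

Referee (rh-split-ref g0) addenda on cards/SPLIT-li-finite.md 19:02Z / 19:46Z: SketchG2 1349f1ff13a79377 replayed
std on `liHeightLawDensity_two`; V16/V17 multiset witnesses re-checked by hand; class UNCHANGED (barrier-note;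
matrix T15 booked).  Typer replay (rh-split-typer-1 g2): this raw form on the farm rc 0, 0 warnings, 0 sorry,
std axioms.  Filed by rh-split-typer-1 g2 on the lead's GO 2026-08-26T19:39Z/19:40Z (HANDOFF-list item 6b).

HONEST LABEL: «SPLITTING SEARCH over kernel-typed RH-EQUIVALENCES; a splitting A ∧ B ⟹ RH is CONDITIONAL
bookkeeping unless A and B are both proved; nothing here bears on the truth of RH.»
-/

set_option linter.dupNamespace false

noncomputable section

namespace Summit.RiemannHypothesis.RiemannHypothesis.Theorems.Splittings.LiResidueClasses

open Complex
open Literature.NumberTheory.LFunctions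
open Literature.NumberTheory.DiophantineGeometry (RiemannHypothesisUpTo)
open Summit.RiemannHypothesis.RiemannHypothesis.Theorems.Splittings.LiProgressionBL

/-! ## §1 Li along residue classes: the class `0 mod q` is a THEOREM, the odd class is multiset-false -/

/-- **«RH ↔ (λ_n)_{n ≡ 0 (mod q)} bounded below» for every `q ≥ 1`** — the residue class `0` of census V16 is
the progression `qℕ` of the landed Bombieri–Lagarias-road theorem
`riemannHypothesis_iff_keiperLiCoeff_mul_bddBelow`. -/
theorem riemannHypothesis_iff_keiperLiCoeff_residueClass_zero_bddBelow {q : ℕ} (hq : 1 ≤ q) :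
    _root_.RiemannHypothesis ↔ ∃ C : ℝ, ∀ n : ℕ, 1 ≤ n → n % q = 0 → -C ≤ keiperLiCoeff n := by
  rw [riemannHypothesis_iff_keiperLiCoeff_mul_bddBelow hq]
  constructor
  · rintro ⟨C, hC⟩
    refine ⟨C, fun n hn hmod ↦ ?_⟩
    obtain ⟨k, rfl⟩ := Nat.dvd_of_mod_eq_zero hmod
    have hk : 1 ≤ k := by
      rcases Nat.eq_zero_or_pos k with h | h
      · subst h; simp at hn
      · exact h
    exact hC k hk
  · rintro ⟨C, hC⟩
    refine ⟨C, fun k hk ↦ hC (q * k) ?_ ?_⟩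
    · calc 1 = 1 * 1 := by ring
        _ ≤ q * k := Nat.mul_le_mul hq hk
    · simp

/-- **MULTISET-LEVEL WITNESS against the ODD class (`q = 2`, `a = 1`)**: the conjugation-closed pair with
`1 − 1/ρ = ± i·r` has Li sum exactly `2 > 0` at every odd index … [folklore] -/
theorem oddClass_witness_sum (r : ℝ) {n : ℕ} (hn : Odd n) :
    (1 - ((I : ℂ) * r) ^ n).re + (1 - (-((I : ℂ) * r)) ^ n).re = 2 := by
  rw [Odd.neg_pow hn]
  simp only [sub_re, one_re, neg_re]
  ring

/-- … while for `r > 1` the pair lies OFF the line `Re ρ = 1/2` (indeed `Re ρ < 1/2`, `ρ = 1/(1 - i r)`): so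
«Li sums bounded below along odd `n` ⟹ all `Re ρ ≥ 1/2`» is FALSE for Bombieri–Lagarias multisets, and the
`ζ`-level residue-class criterion for `a ≢ 0 (mod q)` needs arithmetic input. [folklore] -/
theorem oddClass_witness_offLine {r : ℝ} (hr : 1 < r) : ¬ (1 / 2 ≤ (1 / (1 - (I : ℂ) * r)).re) := by
  have hne : (1 : ℂ) - I * r ≠ 0 := by
    intro h
    have := congrArg Complex.re h
    simp at this
  have h0 : (1 : ℂ) / (1 - I * r) ≠ 0 := by
    rw [one_div]; exact inv_ne_zero hne
  rw [← norm_one_sub_one_div_le_one_iff h0]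
  have : (1 : ℂ) - 1 / (1 / (1 - I * r)) = I * r := by
    rw [one_div_one_div]; ring
  rw [this, norm_mul, Complex.norm_I, one_mul, Complex.norm_real, Real.norm_eq_abs, abs_of_pos (by linarith)]
  linarith

/-! ## §2 The density-sharpened Li height-law family: monotone in `c`, rung `c = 2` landed, RH gives all `c` -/

/-- The family «`∃ T₀, ∀ T ≥ T₀, RH(≤ T) ⟹ λ_n ≥ 0 for 1 ≤ n ≤ c T² log T`» is monotone: a larger constant is a
stronger law. [folklore] -/
theorem liHeightLaw_const_mono {c c' : ℝ} (h : c ≤ c')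
    (hc' : ∃ T₀ : ℝ, ∀ ⦃T : ℝ⦄, T₀ ≤ T → RiemannHypothesisUpTo T →
      ∀ ⦃n : ℕ⦄, 1 ≤ n → (n : ℝ) ≤ c' * T ^ 2 * Real.log T → 0 ≤ keiperLiCoeff n) :
    ∃ T₀ : ℝ, ∀ ⦃T : ℝ⦄, T₀ ≤ T → RiemannHypothesisUpTo T →
      ∀ ⦃n : ℕ⦄, 1 ≤ n → (n : ℝ) ≤ c * T ^ 2 * Real.log T → 0 ≤ keiperLiCoeff n := by
  obtain ⟨T₀, hT₀⟩ := hc'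
  refine ⟨max T₀ 1, fun T hT hRH n hn hnc ↦ hT₀ ((le_max_left _ _).trans hT) hRH hn (hnc.trans ?_)⟩
  have hT1 : 1 ≤ T := (le_max_right _ _).trans hT
  have : 0 ≤ T ^ 2 * Real.log T := mul_nonneg (by positivity) (Real.log_nonneg hT1)
  nlinarith

/-- **The tree's rung `c = 2`** (`T₀ = 1000`; Brown's logarithmic range, kernel theorem
`LiTheory.liHeightLawLog_holds`, RH-FREE): RH verified to height `T ≥ 1000` ⟹ `λ_n ≥ 0` for every
`1 ≤ n ≤ 2 T² log T`. -/
theorem liHeightLaw_const_two :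
    ∃ T₀ : ℝ, ∀ ⦃T : ℝ⦄, T₀ ≤ T → RiemannHypothesisUpTo T →
      ∀ ⦃n : ℕ⦄, 1 ≤ n → (n : ℝ) ≤ 2 * T ^ 2 * Real.log T → 0 ≤ keiperLiCoeff n :=
  ⟨1000, fun _ hT hRH _ hn hnc ↦ Theorems.LiTheory.liHeightLawLog_holds hT hRH hn hnc⟩

/-- RH gives every constant (trivially: all `λ_n ≥ 0` by Li's criterion); the content of the family is
RH-FREE. -/
theorem liHeightLaw_const_of_rh (hRH : _root_.RiemannHypothesis) (c : ℝ) :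
    ∃ T₀ : ℝ, ∀ ⦃T : ℝ⦄, T₀ ≤ T → RiemannHypothesisUpTo T →
      ∀ ⦃n : ℕ⦄, 1 ≤ n → (n : ℝ) ≤ c * T ^ 2 * Real.log T → 0 ≤ keiperLiCoeff n :=
  ⟨0, fun _ _ _ n hn _ ↦ li_criterion_holds.1 hRH n hn⟩

end Summit.RiemannHypothesis.RiemannHypothesis.Theorems.Splittings.LiResidueClasses

end
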